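import Summits.QuantumFields.YangMills.Theorems.LangevinControlUVOSLegsFromFemtoAndGapStubAssemblySchwartzSeparable

/-!
# Soft OS-assembly toolkit II: subsequential limits of uniformly bounded functionals on Schwartz space

Helper file for stub `stub_assembly` of crux `OSLegsFromFemtoAndGap` (stmt-QuantumFields-9367, line
`dlr-collar-transfer`): the COMPACTNESS THEOREM `exists_subseq_clm_limit` — for countably many families
`T i k : 𝓢(X i, ℂ) →L[ℂ] ℂ` bounded on submodules `M i` by `C i · schwartzNorm (m i)` uniformly in `k`, there are ONE
subsequence `φ` and continuous linear functionals `S i` with the same bounds everywhere such that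
`T i (φ k) F → S i F` for all `F ∈ M i` (diagonal subsequence over a countable `schwartzNorm`-dense subset of each
`M i`, `ε/3`, then Hahn–Banach in the polynormable space `𝓢` — Mathlib
`Module.Dual.exists_continuous_extension_of_le_seminorm`). With `M i = ⁰𝒮` this is the step "uniform E0′ bounds ⇒
subsequential limit Schwinger functions (as tempered distributions with the same E0′ bounds)" of every lattice ⇒ OS
construction (Glimm–Jaffe 1987 §6.1; Osterwalder–Schrader 1975 §2).
-/

noncomputable section

open scoped SchwartzMap Topology
open Filter Set MeasureTheory Literature.MathematicalPhysics.QuantumLattice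

namespace Summit.QuantumFields.YangMills.Theorems.OSLegsFromFemtoAndGap

/-! ### The compactness theorem -/

section Limit

/-- The seminorm `C · schwartzNorm m` (as the Mathlib `Seminorm` `C.toNNReal • (Iic (m,m)).sup 𝓢-family`)
evaluates to `C * schwartzNorm m F` for `0 ≤ C`. [folklore] -/
theorem smul_sup_schwartzSeminormFamily_apply {X : Type*} [NormedAddCommGroup X] [NormedSpace ℝ X] {C : ℝ}
    (hC : 0 ≤ C) (m : ℕ) (F : 𝓢(X, ℂ)) :
    (C.toNNReal • (Finset.Iic (m, m)).sup (schwartzSeminormFamily ℂ X ℂ)) F = C * schwartzNorm m F := by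
  change C.toNNReal • ((Finset.Iic (m, m)).sup (schwartzSeminormFamily ℂ X ℂ)) F = C * schwartzNorm m F
  rw [NNReal.smul_def, Real.coe_toNNReal _ hC, smul_eq_mul]
  rfl

/-- The seminorm `C.toNNReal • (Iic (m,m)).sup 𝓢-family` is continuous for the Schwartz topology. [folklore] -/
theorem continuous_smul_sup_schwartzSeminormFamily (X : Type*) [NormedAddCommGroup X] [NormedSpace ℝ X]
    (C : ℝ) (m : ℕ) :
    Continuous (C.toNNReal • (Finset.Iic (m, m)).sup (schwartzSeminormFamily ℂ X ℂ) : Seminorm ℂ 𝓢(X, ℂ)) := by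
  have hsup : Continuous
      (((Finset.Iic (m, m)).sup (schwartzSeminormFamily ℂ X ℂ) : Seminorm ℂ 𝓢(X, ℂ)) : 𝓢(X, ℂ) → ℝ) :=
    Seminorm.continuous_finsetSup fun i _ => (schwartz_withSeminorms ℂ X ℂ).continuous_seminorm i
  have : ((C.toNNReal • (Finset.Iic (m, m)).sup (schwartzSeminormFamily ℂ X ℂ) : Seminorm ℂ 𝓢(X, ℂ)) :
      𝓢(X, ℂ) → ℝ) =
      fun F => (C.toNNReal : ℝ) * ((Finset.Iic (m, m)).sup (schwartzSeminormFamily ℂ X ℂ) : Seminorm ℂ 𝓢(X, ℂ)) F := by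
    funext F
    change C.toNNReal • ((Finset.Iic (m, m)).sup (schwartzSeminormFamily ℂ X ℂ)) F = _
    rw [NNReal.smul_def, smul_eq_mul]
  rw [this]
  exact continuous_const.mul hsup

/-- **Compactness theorem for Schwinger-type functionals.** Let `ι` be countable and, for each `i`, let
`T i k : 𝓢(X i, ℂ) →L[ℂ] ℂ` (`k ∈ ℕ`) be continuous linear functionals on Schwartz space over a
finite-dimensional `X i`, bounded on a submodule `M i` by `C i · schwartzNorm (m i)` UNIFORMLY in `k`. Then
there are ONE strictly increasing `φ : ℕ → ℕ` and continuous linear functionals `S i` obeying the same bound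
everywhere, with `T i (φ k) F → S i F` for every `i` and every `F ∈ M i`. (Diagonal subsequence over a
countable `schwartzNorm`-dense subset of each `M i`; `ε/3`; Hahn–Banach in the polynormable space `𝓢`.)
This is the soft "uniform E0′ bounds ⇒ subsequential limit Schwinger functions" step of every lattice ⇒ OS
construction (Glimm–Jaffe 1987 §6.1), with `M i = ⁰𝒮`. [folklore] -/
theorem exists_subseq_clm_limit {ι : Type*} [Countable ι] {X : ι → Type*}
    [∀ i, NormedAddCommGroup (X i)] [∀ i, NormedSpace ℝ (X i)] [∀ i, FiniteDimensional ℝ (X i)]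
    (T : (i : ι) → ℕ → (𝓢(X i, ℂ) →L[ℂ] ℂ)) (M : (i : ι) → Submodule ℂ 𝓢(X i, ℂ)) (m : ι → ℕ)
    (C : ι → ℝ) (hC : ∀ i, 0 ≤ C i)
    (hT : ∀ i k, ∀ F ∈ M i, ‖T i k F‖ ≤ C i * schwartzNorm (m i) F) :
    ∃ φ : ℕ → ℕ, StrictMono φ ∧ ∃ S : (i : ι) → (𝓢(X i, ℂ) →L[ℂ] ℂ),
      (∀ i F, ‖S i F‖ ≤ C i * schwartzNorm (m i) F) ∧
      ∀ i, ∀ F ∈ M i, Tendsto (fun k => T i (φ k) F) atTop (𝓝 (S i F)) := by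
  classical
  -- countable dense subsets
  have hD := fun i => schwartz_exists_countable_seminorm_dense (m i) (M i : Set 𝓢(X i, ℂ))
  choose D hDM hDc hDd using hD
  -- the diagonal subsequence over `Σ i, D i`
  haveI : ∀ i, Countable (D i) := fun i => (hDc i).to_subtype
  obtain ⟨φ, hφ, hconv⟩ := exists_strictMono_forall_tendsto (ι := Σ i, D i)
    (u := fun jd k => T jd.1 k (jd.2 : 𝓢(X jd.1, ℂ)))
    (fun jd => ⟨C jd.1 * schwartzNorm (m jd.1) (jd.2 : 𝓢(X jd.1, ℂ)),
      fun k => hT jd.1 k (jd.2 : 𝓢(X jd.1, ℂ)) (hDM jd.1 jd.2.2)⟩)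
  -- convergence on each `M i` by `ε / 3`
  have hconvM : ∀ i, ∀ F ∈ M i, ∃ c : ℂ, Tendsto (fun k => T i (φ k) F) atTop (𝓝 c) := by
    intro i
    refine tendsto_of_seminorm_dense
      ((C i).toNNReal • (Finset.Iic (m i, m i)).sup (schwartzSeminormFamily ℂ (X i) ℂ)) (M i)
      (fun k => (T i (φ k) : 𝓢(X i, ℂ) →ₗ[ℂ] ℂ)) (fun k v hv => ?_) (D i) (hDM i) (fun v hv ε hε => ?_) ?_
    · rw [ContinuousLinearMap.coe_coe, smul_sup_schwartzSeminormFamily_apply (hC i)]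
      exact hT i (φ k) v hv
    · have hC1 : 0 < C i + 1 := by linarith [hC i]
      obtain ⟨G, hG, hGε⟩ := hDd i v hv (ε / (C i + 1)) (div_pos hε hC1)
      refine ⟨G, hG, ?_⟩
      rw [smul_sup_schwartzSeminormFamily_apply (hC i)]
      calc C i * schwartzNorm (m i) (v - G) ≤ C i * (ε / (C i + 1)) :=
            mul_le_mul_of_nonneg_left hGε.le (hC i)
        _ < ε := by
            rw [mul_div_assoc']
            rw [div_lt_iff₀ hC1]
            nlinarith [hC i]
    · rintro d hd
      simpa using hconv ⟨i, ⟨d, hd⟩⟩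
  -- the limit functional on each `M i`, linear and bounded, then Hahn–Banach
  have hS : ∀ i, ∃ g : 𝓢(X i, ℂ) →L[ℂ] ℂ, (∀ F, ‖g F‖ ≤ C i * schwartzNorm (m i) F) ∧
      ∀ F ∈ M i, Tendsto (fun k => T i (φ k) F) atTop (𝓝 (g F)) := by
    intro i
    choose c hc using hconvM i
    -- linearity of the limit
    have hadd : ∀ (v w : 𝓢(X i, ℂ)) (hv : v ∈ M i) (hw : w ∈ M i),
        c (v + w) ((M i).add_mem hv hw) = c v hv + c w hw := fun v w hv hw =>
      tendsto_nhds_unique (hc (v + w) ((M i).add_mem hv hw))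
        (by simpa [map_add] using (hc v hv).add (hc w hw))
    have hsmul : ∀ (a : ℂ) (v : 𝓢(X i, ℂ)) (hv : v ∈ M i),
        c (a • v) ((M i).smul_mem a hv) = a * c v hv := fun a v hv =>
      tendsto_nhds_unique (hc (a • v) ((M i).smul_mem a hv))
        (by simpa [map_smul] using (hc v hv).const_mul a)
    let f : M i →ₗ[ℂ] ℂ :=
      { toFun := fun v => c v v.2
        map_add' := fun v w => by simpa using hadd v w v.2 w.2
        map_smul' := fun a v => by simpa using hsmul a v v.2 }
    have hfv : ∀ v : M i, Tendsto (fun k => T i (φ k) v) atTop (𝓝 (f v)) := fun v => hc v v.2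
    have hfb : ∀ v : M i, ‖f v‖ ≤
        ((C i).toNNReal • (Finset.Iic (m i, m i)).sup (schwartzSeminormFamily ℂ (X i) ℂ) : Seminorm ℂ _) v := by
      intro v
      rw [smul_sup_schwartzSeminormFamily_apply (hC i)]
      exact le_of_tendsto (hfv v).norm (Eventually.of_forall fun k => hT i (φ k) v v.2)
    haveI : PolynormableSpace ℂ 𝓢(X i, ℂ) := (schwartz_withSeminorms ℂ (X i) ℂ).toPolynormableSpace
    obtain ⟨g, hg, hgle⟩ := Module.Dual.exists_continuous_extension_of_le_seminorm (M i) f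
      (continuous_smul_sup_schwartzSeminormFamily (X i) (C i) (m i)) hfb
    refine ⟨g, fun F => ?_, fun F hF => ?_⟩
    · simpa [smul_sup_schwartzSeminormFamily_apply (hC i)] using hgle F
    · have h1 := hfv ⟨F, hF⟩
      have h2 : g F = f ⟨F, hF⟩ := hg ⟨F, hF⟩
      rw [h2]
      exact h1
  choose S hSb hSc using hS
  exact ⟨φ, hφ, S, hSb, hSc⟩

end Limit

end Summit.QuantumFields.YangMills.Theorems.OSLegsFromFemtoAndGap

end
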